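import Mathlib.NumberTheory.Padics.Hensel
import Mathlib.NumberTheory.Padics.RingHoms
import Mathlib.FieldTheory.Finite.Basic
import Literature.NumberTheory.LocalFields.PadicOneUnitRoots
import HarnessLib

/-!
# Cube roots in `ℚ_p` for `p ≡ 2 (mod 3)`, and a rigid sextic number inside `ℚ_17`

`Literature/NumberTheory/LocalFields/PadicSeventeenRigidSextic.lean`. For a prime `p ≡ 2 (mod 3)` the cube
map is a bijection of `ℤ_p^×` (Serre, *A Course in Arithmetic*, Ch. II §3: `ℤ_p^× ≅ 𝔽_p^× × U₁`, `3` prime to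
`p(p − 1)`; Gouvêa, *p-adic Numbers*, §4.6 via Hensel's Lemma Thm. 4.5.2): **`1` is the only cube root of unity
in `ℚ_p`** (`padic_eq_one_of_pow_three_eq_one`) and **every `p`-adic unit is a cube**
(`padic_exists_pow_three_eq_of_norm_eq_one`); no element of `ℚ_p` has norm-cube `p⁻¹`
(`padic_norm_pow_three_ne_inv`). For `p = 17`: `2` is a square in `ℚ_17` (`6² ≡ 2`;
`padic_seventeen_exists_sq_eq_two`), and for a square root `s` of `2` with `5 + 2s` a unit (so `5 − 2s = 17/(5+2s)`
has valuation `1`) the cube root `γ` of `5 + 2s` is RIGID: **`γ` is the only root in `ℚ_17` of its sextic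
`x⁶ − 10x³ + 17 = (x³ − 5)² − 8`** (`padic_seventeen_rigid_sextic`) — the other roots are `ζγ` (`ζ³ = 1`,
`ζ ≠ 1`, absent) and cube roots of `5 − 2s` (valuation `1/3`, absent). Consumer: the abc-iut cell's base-category
example `FinSubextCat ℚ ℚ_[17]` that is not of FSMFF-type ([FrdI] §0), where the number field `ℚ(γ) ⊇ ℚ(√2)` has a
unique embedding into `ℚ_17` although `ℚ(√2)` has two.

## References
* [Serre1973] J.-P. Serre, *A Course in Arithmetic*, GTM 7 — Ch. II §3.2–3.3 (structure of `ℤ_p^×`, squares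
  and powers in `ℚ_p`).
* [Gouvea1993PadicNumbers] F. Q. Gouvêa, *p-adic Numbers*, Springer 1993 — Thm. 4.5.2 (Hensel's Lemma),
  §4.6 (applications: roots of unity, squares).
-/

noncomputable section

open Polynomial

namespace Literature.NumberTheory.LocalFields

variable {p : ℕ} [hp : Fact p.Prime]

/-- `p ∤ 3` for a prime `p ≡ 2 (mod 3)`. [folklore] -/
private theorem not_dvd_three_of_mod_three_eq_two (hp3 : p % 3 = 2) : ¬ p ∣ 3 := by
  intro h
  rcases (Nat.prime_three.eq_one_or_self_of_dvd p h) with h1 | h1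
  · exact hp.out.one_lt.ne' h1
  · omega

/-- **The only cube root of unity in `ℚ_p` is `1` when `p ≡ 2 (mod 3)`** (`x³ = 1` forces `x ∈ ℤ_p^×`; its
residue `z ∈ 𝔽_p^×` has `z³ = 1 = z^{p−1}` with `gcd(3, p − 1) = 1`, so `z = 1`; then `x² + x + 1 ≡ 3` is a unit and
`(x − 1)(x² + x + 1) = 0`). [cite: Serre1973, Ch. II §3.3 (roots of unity in ℚ_p)] -/
theorem padic_eq_one_of_pow_three_eq_one (hp3 : p % 3 = 2) {x : ℚ_[p]} (hx : x ^ 3 = 1) : x = 1 := by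
  have hnx : ‖x‖ = 1 := by
    have h := congrArg norm hx
    rw [norm_pow, norm_one] at h
    exact (pow_eq_one_iff_of_nonneg (norm_nonneg x) (by norm_num)).mp h
  -- lift to `ℤ_p`
  set x' : ℤ_[p] := ⟨x, hnx.le⟩ with hx'def
  have hx'3 : x' ^ 3 = 1 := PadicInt.ext (by rw [PadicInt.coe_pow, PadicInt.coe_one]; exact hx)
  -- the residue is a cube root of unity in `𝔽_p`, hence `1`
  set z : ZMod p := PadicInt.toZMod x' with hzdef
  have hz3 : z ^ 3 = 1 := by rw [hzdef, ← map_pow, hx'3, map_one]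
  have hz0 : z ≠ 0 := by
    intro h
    rw [h, zero_pow three_ne_zero] at hz3
    exact zero_ne_one hz3
  have hzp : z ^ (p - 1) = 1 := ZMod.pow_card_sub_one_eq_one hz0
  have hgcd : Nat.gcd 3 (p - 1) = 1 := by
    have h1 : (p - 1) % 3 = 1 := by
      have := hp.out.two_le
      omega
    rw [Nat.gcd_rec, h1]
    exact Nat.gcd_one_left 3
  have hz1 : z = 1 := by
    have h := (pow_gcd_eq_one (a := z) (m := 3) (n := p - 1)).mpr ⟨hz3, hzp⟩
    rwa [hgcd, pow_one] at h
  -- `x'² + x' + 1 ≡ 3 (mod p)` is a unit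
  have h3 : (PadicInt.toZMod (x' ^ 2 + x' + 1)) ≠ 0 := by
    rw [map_add, map_add, map_pow, map_one, ← hzdef, hz1, one_pow,
      show (1 : ZMod p) + 1 + 1 = ((3 : ℕ) : ZMod p) by norm_num, Ne, ZMod.natCast_eq_zero_iff]
    exact not_dvd_three_of_mod_three_eq_two hp3
  have hunit : IsUnit (x' ^ 2 + x' + 1) := by
    by_contra hnu
    apply h3
    have hmem : x' ^ 2 + x' + 1 ∈ IsLocalRing.maximalIdeal ℤ_[p] :=
      (IsLocalRing.mem_maximalIdeal _).mpr (mem_nonunits_iff.mpr hnu)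
    rw [← PadicInt.ker_toZMod, RingHom.mem_ker] at hmem
    exact hmem
  have hprod : (x' - 1) * (x' ^ 2 + x' + 1) = 0 := by
    have : (x' - 1) * (x' ^ 2 + x' + 1) = x' ^ 3 - 1 := by ring
    rw [this, hx'3, sub_self]
  have hx'1 : x' = 1 := sub_eq_zero.mp ((hunit.mul_left_eq_zero).mp hprod)
  have := congrArg (fun t : ℤ_[p] => (t : ℚ_[p])) hx'1
  simpa [hx'def] using this

/-- **Every unit of `ℚ_p` is a cube when `p ≡ 2 (mod 3)`**: `u^{p−1}` is a `1`-unit, hence a cube `w³` by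
Hensel (`3` prime to `p`), and `p − 1 = 3j + 1` gives `u = (w / u^j)³`.
[cite: Serre1973, Ch. II §3.2 Prop. 8 (structure of U₁)] [cite: Gouvea1993PadicNumbers, Thm. 4.5.2 (Hensel's Lemma)] -/
theorem padic_exists_pow_three_eq_of_norm_eq_one (hp3 : p % 3 = 2) {u : ℚ_[p]} (hu : ‖u‖ = 1) :
    ∃ y : ℚ_[p], y ^ 3 = u := by
  set u' : ℤ_[p] := ⟨u, hu.le⟩ with hu'def
  have hu' : ‖u'‖ = 1 := hu
  have hz : PadicInt.toZMod u' ≠ 0 := by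
    intro h
    have hmem : u' ∈ IsLocalRing.maximalIdeal ℤ_[p] := by
      rw [← PadicInt.ker_toZMod, RingHom.mem_ker, h]
    have hlt : ‖u'‖ < 1 := PadicInt.mem_nonunits.mp ((IsLocalRing.mem_maximalIdeal _).mp hmem)
    rw [hu'] at hlt
    exact lt_irrefl _ hlt
  have h1 : ‖u' ^ (p - 1) - 1‖ < 1 := by
    rw [← PadicInt.mem_nonunits, ← IsLocalRing.mem_maximalIdeal, ← PadicInt.ker_toZMod, RingHom.mem_ker,
      map_sub, map_pow, map_one, ZMod.pow_card_sub_one_eq_one hz, sub_self]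
  obtain ⟨w, hw, -⟩ :=
    padicInt_exists_pow_eq_of_norm_sub_one_lt (not_dvd_three_of_mod_three_eq_two hp3) h1
  obtain ⟨j, hj⟩ : ∃ j, p - 1 = 3 * j + 1 := ⟨(p - 1) / 3, by have := hp.out.two_le; omega⟩
  have hu0 : u ≠ 0 := by
    intro h
    rw [h, norm_zero] at hu
    exact zero_ne_one hu
  refine ⟨(w : ℚ_[p]) / u ^ j, ?_⟩
  have hw' : ((w : ℚ_[p])) ^ 3 = u ^ (p - 1) := by
    have := congrArg (fun t : ℤ_[p] => (t : ℚ_[p])) hw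
    simpa [hu'def, PadicInt.coe_pow] using this
  rw [div_pow, hw', hj, div_eq_iff (pow_ne_zero _ (pow_ne_zero _ hu0))]
  ring

/-- No element of `ℚ_p` has `‖x‖³ = p⁻¹` (norms are integral powers of `p`): an element of valuation `1` has no
cube root. [cite: Gouvea1993PadicNumbers, §4.6 (valuation obstruction)] -/
theorem padic_norm_pow_three_ne_inv (x : ℚ_[p]) : ‖x‖ ^ 3 ≠ (p : ℝ)⁻¹ := by
  intro h
  by_cases hx : x = 0
  · rw [hx, norm_zero, zero_pow three_ne_zero] at h
    exact (inv_pos.mpr (by exact_mod_cast hp.out.pos : (0 : ℝ) < p)).ne h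
  rw [Padic.norm_eq_zpow_neg_valuation hx, ← zpow_natCast, ← zpow_mul, ← zpow_neg_one] at h
  have h1p : 1 < (p : ℝ) := by exact_mod_cast hp.out.one_lt
  have := (zpow_right_strictMono₀ h1p).injective h
  omega

/-- **`2` is a square in `ℚ_17`** (`18 = 2·3²` is a `1`-unit of `ℤ_17`, hence a square `y²` by Hensel; take
`y / 3`). [cite: Gouvea1993PadicNumbers, §4.6 (squares in ℚ_p via Hensel's Lemma)] -/
theorem padic_seventeen_exists_sq_eq_two [Fact (Nat.Prime 17)] : ∃ s : ℚ_[17], s ^ 2 = 2 := by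
  have h1 : ‖(18 : ℤ_[17]) - 1‖ < 1 := by
    rw [show (18 : ℤ_[17]) - 1 = ((17 : ℕ) : ℤ_[17]) by norm_num, PadicInt.norm_p]
    norm_num
  obtain ⟨y, hy, -⟩ := padicInt_exists_pow_eq_of_norm_sub_one_lt (p := 17) (n := 2) (by norm_num) h1
  refine ⟨(y : ℚ_[17]) / 3, ?_⟩
  have hy' : ((y : ℚ_[17])) ^ 2 = 18 := by
    have h := congrArg (fun t : ℤ_[17] => (t : ℚ_[17])) hy
    exact h
  rw [div_pow, hy']
  norm_num

/-- **A rigid sextic number in `ℚ_17`.** There are `s, γ ∈ ℚ_17` with `s² = 2`, `γ³ = 5 + 2s`, such that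
`5 − 2s` (`= 17 / (5 + 2s)`, valuation `1`) has no cube root in `ℚ_17` and `γ` is the ONLY root in `ℚ_17` of
`x⁶ − 10x³ + 17 = (x³ − 5 − 2s)(x³ − 5 + 2s)` (cube roots of `5 + 2s` are `γ` times a cube root of unity, and
`μ₃(ℚ_17) = 1` as `17 ≡ 2 (mod 3)`). [cite: Serre1973, Ch. II §3.3 (powers and roots of unity in ℚ_p)]
[cite: Gouvea1993PadicNumbers, Thm. 4.5.2 (Hensel's Lemma)] -/
theorem padic_seventeen_rigid_sextic [Fact (Nat.Prime 17)] :
    ∃ s γ : ℚ_[17], s ^ 2 = 2 ∧ γ ^ 3 = 5 + 2 * s ∧ (∀ x : ℚ_[17], x ^ 3 ≠ 5 - 2 * s) ∧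
      ∀ g : ℚ_[17], g ^ 6 - 10 * g ^ 3 + 17 = 0 → g = γ := by
  obtain ⟨s₀, hs₀⟩ := padic_seventeen_exists_sq_eq_two
  -- norms: `‖5 ± 2t‖ ≤ 1`, product `17`
  have h2 : ‖(2 : ℚ_[17])‖ = 1 := by
    rw [show (2 : ℚ_[17]) = ((2 : ℕ) : ℚ_[17]) by norm_num, Padic.norm_natCast_eq_one_iff]
    norm_num
  have h5 : ‖(5 : ℚ_[17])‖ ≤ 1 := by
    rw [show (5 : ℚ_[17]) = ((5 : ℤ) : ℚ_[17]) by norm_num]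
    exact Padic.norm_int_le_one 5
  have hle : ∀ t : ℚ_[17], t ^ 2 = 2 → ‖5 + 2 * t‖ ≤ 1 := by
    intro t ht
    have hnt : ‖t‖ = 1 := by
      have h := congrArg norm ht
      rw [norm_pow, h2] at h
      exact (pow_eq_one_iff_of_nonneg (norm_nonneg t) (by norm_num)).mp h
    refine (Padic.nonarchimedean _ _).trans (max_le h5 ?_)
    rw [norm_mul, h2, hnt, one_mul]
  have hprod : ∀ t : ℚ_[17], t ^ 2 = 2 → ‖5 + 2 * t‖ * ‖5 - 2 * t‖ = (17 : ℝ)⁻¹ := by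
    intro t ht
    rw [← norm_mul, show (5 + 2 * t) * (5 - 2 * t) = 25 - 4 * t ^ 2 by ring, ht,
      show (25 : ℚ_[17]) - 4 * 2 = ((17 : ℕ) : ℚ_[17]) by norm_num, Padic.norm_p]
    norm_num
  -- a norm `< 1` is `≤ 17⁻¹`
  have hsmall : ∀ x : ℚ_[17], ‖x‖ < 1 → ‖x‖ ≤ (17 : ℝ)⁻¹ := by
    intro x hx
    have h := (Padic.norm_le_pow_iff_norm_lt_pow_add_one x (-1)).mpr (by simpa using hx)
    simpa using h
  -- choose the sign of `s` so that `5 + 2s` is a unit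
  obtain ⟨s, hs, hm, hmbar⟩ : ∃ s : ℚ_[17], s ^ 2 = 2 ∧ ‖5 + 2 * s‖ = 1 ∧ ‖5 - 2 * s‖ = (17 : ℝ)⁻¹ := by
    by_cases hlt : ‖5 + 2 * s₀‖ < 1
    · -- then `5 - 2 s₀` is the unit: take `s = -s₀`
      have hs₀' : (-s₀) ^ 2 = 2 := by rw [neg_sq, hs₀]
      have hle' : ‖5 - 2 * s₀‖ ≤ 1 := by simpa [sub_eq_add_neg] using hle (-s₀) hs₀'
      have hbar : ‖5 - 2 * s₀‖ = 1 := by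
        by_contra hne
        have hlt' : ‖5 - 2 * s₀‖ < 1 := lt_of_le_of_ne hle' hne
        have h1 := hsmall _ hlt
        have h2' := hsmall _ hlt'
        have hp := hprod s₀ hs₀
        have : ‖5 + 2 * s₀‖ * ‖5 - 2 * s₀‖ ≤ (17 : ℝ)⁻¹ * (17 : ℝ)⁻¹ :=
          mul_le_mul h1 h2' (norm_nonneg _) (by norm_num)
        rw [hp] at this
        norm_num at this
      refine ⟨-s₀, hs₀', by simpa [sub_eq_add_neg] using hbar, ?_⟩
      have hp := hprod s₀ hs₀
      rw [hbar, mul_one] at hp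
      simpa using hp
    · have hunit : ‖5 + 2 * s₀‖ = 1 := le_antisymm (hle s₀ hs₀) (not_lt.mp hlt)
      refine ⟨s₀, hs₀, hunit, ?_⟩
      have hp := hprod s₀ hs₀
      rwa [hunit, one_mul] at hp
  -- the cube root of the unit `5 + 2s`
  obtain ⟨γ, hγ⟩ := padic_exists_pow_three_eq_of_norm_eq_one (p := 17) (by norm_num) hm
  have hm0 : (5 + 2 * s : ℚ_[17]) ≠ 0 := by
    intro h
    rw [h, norm_zero] at hm
    exact zero_ne_one hm
  have hγ0 : γ ≠ 0 := by
    intro h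
    rw [h, zero_pow three_ne_zero] at hγ
    exact hm0 hγ.symm
  -- no cube root of `5 - 2s`
  have hN : ∀ x : ℚ_[17], x ^ 3 ≠ 5 - 2 * s := by
    intro x hx
    have h := congrArg norm hx
    rw [norm_pow, hmbar] at h
    exact padic_norm_pow_three_ne_inv (p := 17) x (by exact_mod_cast h)
  refine ⟨s, γ, hs, hγ, hN, fun g hg => ?_⟩
  -- `(g³ - 5)² = (2s)²`
  have hsq : (g ^ 3 - 5) ^ 2 = (2 * s) ^ 2 := by linear_combination hg - 4 * hs
  rcases eq_or_eq_neg_of_sq_eq_sq _ _ hsq with h1 | h1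
  · -- `g³ = 5 + 2s = γ³`, so `g/γ` is a cube root of unity
    have hg3 : g ^ 3 = γ ^ 3 := by rw [hγ]; linear_combination h1
    have hq : (g / γ) ^ 3 = 1 := by rw [div_pow, hg3, div_self (pow_ne_zero _ hγ0)]
    have := padic_eq_one_of_pow_three_eq_one (p := 17) (by norm_num) hq
    exact (div_eq_one_iff_eq hγ0).mp this
  · exact (hN g (by linear_combination h1)).elim

end Literature.NumberTheory.LocalFields

end
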